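import Literature.AlgebraicGeometry.Frobenioids.BaseSectionsOfObjectsCor57bProofs
import Literature.AlgebraicGeometry.Frobenioids.EquivalenceThm34Assembly
import Literature.AlgebraicGeometry.Frobenioids.EquivalencePreStepsQuasiIsotropic
import Literature.AlgebraicGeometry.Frobenioids.Thm34vSlim
import HarnessLib

/-!
# Frobenioids I, Corollary 5.7 (Category-theoreticity of Base-Sections) UNCONDITIONALLY over SLIM bases of
# FSM-type; Corollary 4.11 (ii) over slim bases (= Theorem 3.4 (v), Remark 4.11.1)

Mochizuki, *The geometry of Frobenioids I: the general theory*, Kyushu J. Math. **62** (2008)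
293–400, Cor. 5.7 (i)–(iv) pp. 107–108 [cite: MochizukiFrdI2008, Cor. 5.7 p.107]; Cor. 4.11 (ii) p. 91 and
Remark 4.11.1 p. 94: "Corollary 4.11, (ii), may be regarded — at least in the case where the divisor monoids
involved are perf-factorial — as a substantial strengthening of Theorem 3.4, (v) [i.e., one replaces the
hypothesis that the base categories be slim by the hypothesis that they be Div-slim]"
[cite: MochizukiFrdI2008, Rem. 4.11.1 p.94]; Thm. 3.4 (v) p. 63.

PROOF-ONLY file (abc-iut cell, seat abc-iut-w4-d086; row W4 of `plan/L1/DISCHARGE-L1.md` §0). The landed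
proofs of Cor. 5.7 (abc-iut-L1-d6, `BaseSectionsOfObjectsCor57Proofs.lean` / `…Cor57bProofs.lean`) are
conditional on the typed per-instance [FrdI] Thm. 3.4 (ii)/(iii) and Cor. 4.11 (ii). Over bases of FSM-type
(the cell's repaired base hypothesis) Thm. 3.4 (ii)/(iii) are theorems (abc-iut-L1-t13 `FrdI.thm34ii_of_isOfFSMType`,
abc-iut-w4-d033 `FrdI.thm34iii_ofFunctor_of_isOfFSMType`); and over SLIM bases the conclusion of the typed
Cor. 4.11 (ii) — a `1`-unique `Ψ^Base` fitting into the `1`-commutative projection square, with rigid composites —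
is exactly the conclusion of Thm. 3.4 (v), a theorem of the tree (abc-iut-L1-d4's capstone
`PreFrobenioid.thm34v_conclusion_of_preserves_baseIso`, needing only that `Ψ` and `Ψ⁻¹` preserve
base-isomorphisms, which Thm. 3.4 (iii) supplies under the Cor. 4.11 setting). Hence:

* `cor411ii_inst_of_isSlim_of_isOfFSMType` — the typed per-instance Cor. 4.11 (ii) for Frobenioids over SLIM
  bases of FSM-type (the slim case of print's Div-slim statement);
* `cor57i_sections_of_isSlim`, `cor57i_pairs_of_isSlim`, `isOfPreModelType_iff_of_isSlim`, `cor57ii_of_isSlim`,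
  `cor57iii_of_isSlim`, `cor57iv_of_isSlim` — [FrdI] Cor. 5.7 (i)–(iv) AS TYPED, UNCONDITIONALLY for Frobenioids
  over slim bases of FSM-type (the hypotheses `Cor57Hypotheses` of the typed statements — perf-factorial,
  Div-slim, standard type, base-isomorphisms in the group-like case — are kept; slimness and FSM-type are the
  extra hypotheses; the general Div-slim case waits for the apex of the sub-DAG `plan/L1/SUBDAG-FrdI-Cor411.md`
  and is served by the companion `BaseSectionsOfObjectsCor57FSM.lean`).
Nothing here is specific to the abc programme; no statement of the paper is restated or strengthened; nothing
bears on [IUTchIII] Cor. 3.12.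
-/

namespace Literature.AlgebraicGeometry.Frobenioids

open CategoryTheory Opposite

universe w v v' u u'

namespace PreFrobenioid

section Cor57Slim

variable {D₁ : Type u} [Category.{v} D₁] {Φ₁ : D₁ᵒᵖ ⥤ CommMonCat.{w}}
  {C₁ : Type u'} [Category.{v'} C₁] (F₁ : C₁ ⥤ ElemFrobenioid Φ₁)
  {D₂ : Type u} [Category.{v} D₂] {Φ₂ : D₂ᵒᵖ ⥤ CommMonCat.{w}}
  {C₂ : Type u'} [Category.{v'} C₂] (F₂ : C₂ ⥤ ElemFrobenioid Φ₂) (Ψ : C₁ ≌ C₂)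

/-- **[FrdI] Cor. 4.11 (ii) over SLIM bases of FSM-type** (the typed per-instance statement
`PreFrobenioidData.Cor411ii`): for Frobenioids `C_i → F_{Φ_i}` over slim bases of FSM-type, under the
Cor. 4.11 setting (Div-slim, standard type, hypothesis (b)) there is a `1`-unique `Ψ^Base : D₁ → D₂` with the
`1`-commutative projection square, and the composite functors are rigid. (Slim case = Thm. 3.4 (v), Rem. 4.11.1:
`Ψ`, `Ψ⁻¹` preserve base-isomorphisms by Thm. 3.4 (iii) over FSM-type bases, then abc-iut-L1-d4's capstone.)
[cite: MochizukiFrdI2008, Cor. 4.11 (ii) p.91] -/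
theorem cor411ii_inst_of_isSlim_of_isOfFSMType (hF₁ : IsFrobenioid F₁) (hF₂ : IsFrobenioid F₂)
    (hD₁ : IsOfFSMType D₁) (hD₂ : IsOfFSMType D₂) (hs₁ : IsSlim D₁) (hs₂ : IsSlim D₂) :
    (PreFrobenioidData.ofFunctor Φ₁ F₁).Cor411ii (PreFrobenioidData.ofFunctor Φ₂ F₂) Ψ := by
  intro hset
  have hB' : (PreFrobenioidData.ofFunctor Φ₂ F₂).HypB (PreFrobenioidData.ofFunctor Φ₁ F₁) Ψ.symm :=
    fun g₂ g₁ => ⟨(hset.hypB g₁ g₂).2, (hset.hypB g₁ g₂).1⟩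
  have h3 := FrdI.thm34iii_ofFunctor_of_isOfFSMType hF₁ hF₂ hD₁ hD₂ Ψ hset.standard.1 hset.standard.2 hset.hypB
  have h3' := FrdI.thm34iii_ofFunctor_of_isOfFSMType hF₂ hF₁ hD₂ hD₁ Ψ.symm hset.standard.2 hset.standard.1 hB'
  obtain ⟨-, -, ΨBase, hsq, hr₁, hr₂⟩ := thm34v_conclusion_of_preserves_baseIso hF₁ hF₂ Ψ hs₁ hs₂
    (fun X Y f hf => h3.1.2.2.1 f hf) (fun X Y f hf => h3'.1.2.2.1 f hf)
  exact ⟨ΨBase, hsq, fun _ _ => ⟨hr₁, hr₂⟩⟩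

/-- **[FrdI] Cor. 5.7 (i), base-sections, UNCONDITIONALLY over slim bases of FSM-type**: `Ψ` maps every
base-section of `C₁` into a base-section of `C₂`. [cite: MochizukiFrdI2008, Cor. 5.7 (i) p.107] -/
theorem cor57i_sections_of_isSlim (hD₁ : IsOfFSMType D₁) (hD₂ : IsOfFSMType D₂) (hs₁ : IsSlim D₁)
    (hs₂ : IsSlim D₂) : Cor57i_sections F₁ F₂ Ψ := fun hyp =>
  cor57i_sections_of F₁ F₂ Ψ
    (FrdI.thm34iii_ofFunctor_of_isOfFSMType hyp.isFrobenioid₁ hyp.isFrobenioid₂ hD₁ hD₂ Ψ)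
    (cor411ii_inst_of_isSlim_of_isOfFSMType F₁ F₂ Ψ hyp.isFrobenioid₁ hyp.isFrobenioid₂ hD₁ hD₂ hs₁ hs₂) hyp

/-- **[FrdI] Cor. 5.7 (i), quasi-base-Frobenius pairs, UNCONDITIONALLY over slim bases of FSM-type.**
[cite: MochizukiFrdI2008, Cor. 5.7 (i) p.107] -/
theorem cor57i_pairs_of_isSlim (hD₁ : IsOfFSMType D₁) (hD₂ : IsOfFSMType D₂) (hs₁ : IsSlim D₁)
    (hs₂ : IsSlim D₂) : Cor57i_pairs F₁ F₂ Ψ := fun hyp =>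
  cor57i_pairs_of F₁ F₂ Ψ
    (FrdI.thm34iii_ofFunctor_of_isOfFSMType hyp.isFrobenioid₁ hyp.isFrobenioid₂ hD₁ hD₂ Ψ)
    (cor411ii_inst_of_isSlim_of_isOfFSMType F₁ F₂ Ψ hyp.isFrobenioid₁ hyp.isFrobenioid₂ hD₁ hD₂ hs₁ hs₂) hyp

/-- **[FrdI] Cor. 5.7 (i), "in particular, `C₁` is of model type iff `C₂` is" (pre-model half), UNCONDITIONALLY
over slim bases of FSM-type.** [cite: MochizukiFrdI2008, Cor. 5.7 (i) p.107] -/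
theorem isOfPreModelType_iff_of_isSlim (hD₁ : IsOfFSMType D₁) (hD₂ : IsOfFSMType D₂) (hs₁ : IsSlim D₁)
    (hs₂ : IsSlim D₂) (hyp : Cor57Hypotheses F₁ F₂ Ψ) : IsOfPreModelType F₁ ↔ IsOfPreModelType F₂ :=
  isOfPreModelType_iff_of F₁ F₂ Ψ
    (FrdI.thm34iii_ofFunctor_of_isOfFSMType hyp.isFrobenioid₁ hyp.isFrobenioid₂ hD₁ hD₂ Ψ)
    (cor411ii_inst_of_isSlim_of_isOfFSMType F₁ F₂ Ψ hyp.isFrobenioid₁ hyp.isFrobenioid₂ hD₁ hD₂ hs₁ hs₂)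
    (FrdI.thm34iii_ofFunctor_of_isOfFSMType hyp.isFrobenioid₂ hyp.isFrobenioid₁ hD₂ hD₁ Ψ.symm)
    (cor411ii_inst_of_isSlim_of_isOfFSMType F₂ F₁ Ψ.symm hyp.isFrobenioid₂ hyp.isFrobenioid₁ hD₂ hD₁ hs₂ hs₁)
    hyp

/-- **[FrdI] Cor. 5.7 (ii) UNCONDITIONALLY over slim bases of FSM-type**: `C₁` is of unit-profinite type iff
`C₂` is. [cite: MochizukiFrdI2008, Cor. 5.7 (ii) p.108] -/
theorem cor57ii_of_isSlim (hD₁ : IsOfFSMType D₁) (hD₂ : IsOfFSMType D₂) (hs₁ : IsSlim D₁) (hs₂ : IsSlim D₂) :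
    Cor57ii F₁ F₂ Ψ := fun hyp =>
  cor57ii_of_cor411ii F₁ F₂ Ψ
    (cor411ii_inst_of_isSlim_of_isOfFSMType F₁ F₂ Ψ hyp.isFrobenioid₁ hyp.isFrobenioid₂ hD₁ hD₂ hs₁ hs₂) hyp

/-- **[FrdI] Cor. 5.7 (iii) UNCONDITIONALLY over slim bases of FSM-type.** [cite: MochizukiFrdI2008, Cor. 5.7 (iii) p.108] -/
theorem cor57iii_of_isSlim (B₁ : (PreFrobenioidData.ofFunctor Φ₁ F₁).BiratData)
    (B₂ : (PreFrobenioidData.ofFunctor Φ₂ F₂).BiratData) (hD₁ : IsOfFSMType D₁) (hD₂ : IsOfFSMType D₂)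
    (hs₁ : IsSlim D₁) (hs₂ : IsSlim D₂) : Cor57iii F₁ F₂ Ψ B₁ B₂ := fun hyp =>
  cor57iii_of F₁ F₂ Ψ B₁ B₂
    (FrdI.thm34iii_ofFunctor_of_isOfFSMType hyp.isFrobenioid₁ hyp.isFrobenioid₂ hD₁ hD₂ Ψ)
    (cor411ii_inst_of_isSlim_of_isOfFSMType F₁ F₂ Ψ hyp.isFrobenioid₁ hyp.isFrobenioid₂ hD₁ hD₂ hs₁ hs₂) hyp

/-- **[FrdI] Cor. 5.7 (iv) UNCONDITIONALLY over slim bases of FSM-type.** [cite: MochizukiFrdI2008, Cor. 5.7 (iv) p.108] -/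
theorem cor57iv_of_isSlim (B₁ : (PreFrobenioidData.ofFunctor Φ₁ F₁).BiratData)
    (B₂ : (PreFrobenioidData.ofFunctor Φ₂ F₂).BiratData) (hD₁ : IsOfFSMType D₁) (hD₂ : IsOfFSMType D₂)
    (hs₁ : IsSlim D₁) (hs₂ : IsSlim D₂) : Cor57iv F₁ F₂ Ψ B₁ B₂ := fun hyp =>
  cor57iv_of F₁ F₂ Ψ B₁ B₂
    (fun hq₁ hq₂ _ _ => FrdI.thm34ii_of_isOfFSMType hyp.isFrobenioid₁ hyp.isFrobenioid₂ hq₁ hq₂ hD₁ hD₂ Ψ)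
    (fun hq₂ hq₁ _ _ => FrdI.thm34ii_of_isOfFSMType hyp.isFrobenioid₂ hyp.isFrobenioid₁ hq₂ hq₁ hD₂ hD₁ Ψ.symm)
    (FrdI.thm34iii_ofFunctor_of_isOfFSMType hyp.isFrobenioid₁ hyp.isFrobenioid₂ hD₁ hD₂ Ψ)
    (cor411ii_inst_of_isSlim_of_isOfFSMType F₁ F₂ Ψ hyp.isFrobenioid₁ hyp.isFrobenioid₂ hD₁ hD₂ hs₁ hs₂) hyp

end Cor57Slim

end PreFrobenioid

end Literature.AlgebraicGeometry.Frobenioids
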